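import Literature.NumberTheory.GaloisRepresentations.GaloisRep
import Literature.RepresentationTheory.Semisimple.BrauerNesbitt
import Literature.RepresentationTheory.Semisimple.CharpolySubquotient
import HarnessLib

/-!
# Reducibility passes to a companion with the same characteristic polynomials
(crux `IrreducibilityBySelfDuality.IrreducibleGL3CM`, item stmt-Langlands-14327, line
`reducible-companion-dispatch`, stub `stub_not_isIrreducible_of_charpoly_eq`)

Let `k` be a field (any characteristic) and `G` a monoid.  If a finite-dimensional representation
`ρ` of `G` over `k` has the same characteristic polynomials `det(X - ρ(g)) = det(X - ρ₀(g))`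
(`g ∈ G`) as a finite-dimensional representation `ρ₀` which is NOT irreducible, then `ρ` is not
irreducible (`not_isIrreducible_of_charpoly_eq`).  Proof, through the `k[G]`-module dictionary
(Mathlib `Representation.irreducible_iff_isSimpleModule_asModule`) and the module statement
`isSimpleModule_of_charpoly_smul_eq`: if `ρ` were irreducible its module `N` would be simple, hence
semisimple; the module `M` of `ρ₀` has the dimension of `N`, so it is non-zero, and it is not
simple, so it has a proper non-zero submodule `S`; the product `S' × Q'` of semisimplifications of
`S` and of `M ⧸ S` (`Module.exists_isSemisimpleModule_charpoly_smul_eq`) is semisimple with the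
characteristic polynomials of `M` (`Module.charpoly_smul_prod`,
`Module.charpoly_smul_eq_mul_quotient`), hence `k[G]`-isomorphic to `N` by the Brauer–Nesbitt
theorem with characteristic polynomials over an arbitrary field (Bourbaki, *Algèbre* VIII, § 20
n° 6, Thm. 2, Cor. 1, p. 378; tree: `Module.nonempty_linearEquiv_of_charpoly_smul_of_eq`), hence
simple — but both factors are non-zero (`dim S' = dim S > 0`, `dim Q' = dim M/S > 0`), and a
product of two non-zero modules is never simple (`not_isSimpleModule_prod`: `S' × 0` is a proper
non-zero submodule).

Specialised to framed Galois representations `Γ_K →ₜ* GL_n(ℚ̄_ℓ)` — the characteristic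
polynomial of the linear map `v ↦ r(g) v` of `ℚ̄_ℓⁿ` is the matrix characteristic polynomial
`FramedRep.charpoly r g` (`charpoly_toRepresentation_apply`, Mathlib `Matrix.charpoly_toLin'`) —
this is the registered stub `stub_not_isIrreducible_of_charpoly_eq` of the line (its
semisimplicity hypothesis on `r` is not even needed: an irreducible representation is semisimple).

References: N. Bourbaki, *Algèbre, Chapitre VIII*, 2ᵉ éd., Springer (2012), § 20 n° 6, Thm. 2,
Cor. 1 (p. 378); C. W. Curtis, I. Reiner, *Representation Theory of Finite Groups and Associative
Algebras* (1962), (30.16).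
-/

noncomputable section
open Literature.NumberTheory.GaloisRepresentations
open Literature.RepresentationTheory.Semisimple

namespace Summit.Langlands.Langlands.Theorems.IrreducibleGL3CM

open Module

universe u v w w'

/-! ### Modules: a product of two non-zero modules is not simple -/

section Ring

variable {R : Type u} [Ring R]

/-- A product `S × Q` of two non-zero `R`-modules is not a simple module: `S × 0`
(`Submodule.prod ⊤ ⊥`) is a submodule which is neither `⊥` (as `S ≠ 0`) nor `⊤` (as `Q ≠ 0`).
[folklore] -/
theorem not_isSimpleModule_prod (S : Type w) (Q : Type w') [AddCommGroup S] [Module R S]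
    [AddCommGroup Q] [Module R Q] [Nontrivial S] [Nontrivial Q] : ¬ IsSimpleModule R (S × Q) := by
  intro h
  rcases eq_bot_or_eq_top ((⊤ : Submodule R S).prod (⊥ : Submodule R Q)) with h1 | h1
  · rw [Submodule.prod_eq_bot_iff] at h1
    exact top_ne_bot h1.1
  · rw [Submodule.prod_eq_top_iff] at h1
    exact bot_ne_top h1.2

/-- A non-zero module which is not simple has a proper non-zero submodule (the lattice of
submodules is non-trivial, so "simple" just says every submodule is `⊥` or `⊤`). [folklore] -/
theorem exists_ne_bot_ne_top_of_not_isSimpleModule {M : Type w} [AddCommGroup M] [Module R M]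
    [Nontrivial M] (h : ¬ IsSimpleModule R M) : ∃ S : Submodule R M, S ≠ ⊥ ∧ S ≠ ⊤ := by
  by_contra hcon
  push Not at hcon
  exact h { eq_bot_or_eq_top := fun S ↦ or_iff_not_imp_left.mpr (hcon S) }

end Ring

/-! ### Modules over a monoid algebra: simplicity is read off the characteristic polynomials -/

section MonoidAlgebra

variable {k : Type u} [Field k] {G : Type v} [Monoid G]

/-- **Simplicity is detected by characteristic polynomials** (a corollary of the Brauer–Nesbitt
theorem over an arbitrary field, Bourbaki, *Algèbre* VIII, § 20 n° 6, Thm. 2, Cor. 1).  Let `M`,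
`N` be `k[G]`-modules of finite dimension over the field `k` (compatible `k`-structures) such
that every `g ∈ G` has the same characteristic polynomial on `M` and on `N`.  If `N` is simple,
so is `M`.  Indeed `M ≠ 0` (same dimension as `N`); if `M` had a proper non-zero submodule `S`,
the product `S' × Q'` of semisimplifications of `S` and `M ⧸ S` would be a semisimple module with
the characteristic polynomials of `M`, i.e. of `N`, hence isomorphic to `N` (Brauer–Nesbitt,
`Module.nonempty_linearEquiv_of_charpoly_smul_of_eq`) and simple, although both factors are
non-zero (`not_isSimpleModule_prod`). [folklore] -/
theorem isSimpleModule_of_charpoly_smul_eq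
    {M : Type w} [AddCommGroup M] [Module k M] [Module (MonoidAlgebra k G) M]
    [IsScalarTower k (MonoidAlgebra k G) M] [FiniteDimensional k M]
    {N : Type w'} [AddCommGroup N] [Module k N] [Module (MonoidAlgebra k G) N]
    [IsScalarTower k (MonoidAlgebra k G) N] [FiniteDimensional k N]
    [IsSimpleModule (MonoidAlgebra k G) N]
    (h : ∀ g : G, (DistribSMul.toLinearMap k M (MonoidAlgebra.of k G g)).charpoly =
      (DistribSMul.toLinearMap k N (MonoidAlgebra.of k G g)).charpoly) :
    IsSimpleModule (MonoidAlgebra k G) M := by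
  haveI : Nontrivial N := IsSimpleModule.nontrivial (MonoidAlgebra k G) N
  -- `M ≠ 0`: it has the dimension of `N`
  have hdim : finrank k M = finrank k N := LinearMap.finrank_eq_of_charpoly_eq _ _ (h 1)
  haveI : Nontrivial M := Module.nontrivial_of_finrank_pos (R := k) (hdim ▸ Module.finrank_pos)
  by_contra hM
  -- a proper non-zero submodule `S`, and semisimplifications `S'` of `S`, `Q'` of `M ⧸ S`
  obtain ⟨S, hS0, hS1⟩ := exists_ne_bot_ne_top_of_not_isSimpleModule hM
  haveI := Module.finiteDimensional_submodule_tower (k := k) S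
  haveI : FiniteDimensional k (M ⧸ S) := Module.Finite.quotient k S
  obtain ⟨S', _, _, _, _, _, _, hS'⟩ :=
    Module.exists_isSemisimpleModule_charpoly_smul_eq (k := k) (R := MonoidAlgebra k G) S
  obtain ⟨Q', _, _, _, _, _, _, hQ'⟩ :=
    Module.exists_isSemisimpleModule_charpoly_smul_eq (k := k) (R := MonoidAlgebra k G) (M ⧸ S)
  -- `S' × Q'` is semisimple (binary products: as in `CharpolySubquotient`, via the ranges of
  -- `inl`, `inr`, Mathlib having only the `Π`-instance)
  haveI : IsSemisimpleModule (MonoidAlgebra k G) (S' × Q') := by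
    have h1 : IsSemisimpleModule (MonoidAlgebra k G)
        (LinearMap.range (LinearMap.inl (MonoidAlgebra k G) S' Q')) :=
      .of_surjective _ (LinearMap.inl (MonoidAlgebra k G) S' Q').surjective_rangeRestrict
    have h2 : IsSemisimpleModule (MonoidAlgebra k G)
        (LinearMap.range (LinearMap.inr (MonoidAlgebra k G) S' Q')) :=
      .of_surjective _ (LinearMap.inr (MonoidAlgebra k G) S' Q').surjective_rangeRestrict
    have h12 := IsSemisimpleModule.sup h1 h2
    rw [LinearMap.sup_range_inl_inr] at h12
    exact .congr (Submodule.topEquiv).symm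
  -- `χ_{S' × Q'}(g) = χ_S(g) χ_{M/S}(g) = χ_M(g) = χ_N(g)`
  have hN : ∀ g : G, (DistribSMul.toLinearMap k N (MonoidAlgebra.of k G g)).charpoly =
      (DistribSMul.toLinearMap k (S' × Q') (MonoidAlgebra.of k G g)).charpoly := fun g ↦ by
    rw [Module.charpoly_smul_prod, hS', hQ', ← Module.charpoly_smul_eq_mul_quotient (k := k) S,
      h g]
  -- Brauer–Nesbitt: `N ≃ S' × Q'`, so `S' × Q'` is simple
  obtain ⟨e⟩ := Module.nonempty_linearEquiv_of_charpoly_smul_of_eq (k := k) hN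
  haveI : IsSimpleModule (MonoidAlgebra k G) (S' × Q') := IsSimpleModule.congr e.symm
  -- but both factors are non-zero
  haveI : Nontrivial S' := by
    haveI : Nontrivial S := Submodule.nontrivial_iff_ne_bot.mpr hS0
    have h1 : finrank k S' = finrank k S := LinearMap.finrank_eq_of_charpoly_eq _ _ (hS' 1)
    exact Module.nontrivial_of_finrank_pos (R := k) (h1 ▸ Module.finrank_pos)
  haveI : Nontrivial Q' := by
    haveI : Nontrivial (M ⧸ S) := Submodule.Quotient.nontrivial_iff.mpr hS1
    have h1 : finrank k Q' = finrank k (M ⧸ S) := LinearMap.finrank_eq_of_charpoly_eq _ _ (hQ' 1)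
    exact Module.nontrivial_of_finrank_pos (R := k) (h1 ▸ Module.finrank_pos)
  exact not_isSimpleModule_prod S' Q' ‹_›

/-! ### Representations -/

variable {V : Type w} {W : Type w'} [AddCommGroup V] [Module k V] [FiniteDimensional k V]
  [AddCommGroup W] [Module k W] [FiniteDimensional k W]

/-- **Reducibility passes along equal characteristic polynomials.**  Let `ρ₀`, `ρ` be
finite-dimensional representations of a monoid `G` over a field `k` with
`det(X - ρ(g)) = det(X - ρ₀(g))` for all `g ∈ G`.  If `ρ₀` is not irreducible, neither is `ρ`
(no semisimplicity hypothesis: an irreducible `ρ` has a simple `k[G]`-module, Mathlib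
`Representation.irreducible_iff_isSimpleModule_asModule`, and simplicity passes to the module of
`ρ₀` by `isSimpleModule_of_charpoly_smul_eq`, the characteristic polynomial of `g` on
`ρ.asModule` being that of `ρ(g)`, `Representation.charpoly_smul_asModule`).  Brauer–Nesbitt,
Bourbaki, *Algèbre* VIII, § 20 n° 6, Cor. 1 of Thm. 2. [folklore] -/
theorem not_isIrreducible_of_charpoly_eq (ρ₀ : Representation k G V) (ρ : Representation k G W)
    (h : ∀ g : G, (ρ g).charpoly = (ρ₀ g).charpoly) (h₀ : ¬ ρ₀.IsIrreducible) :
    ¬ ρ.IsIrreducible := by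
  intro hρ
  apply h₀
  rw [Representation.irreducible_iff_isSimpleModule_asModule] at hρ ⊢
  refine isSimpleModule_of_charpoly_smul_eq (k := k) (N := ρ.asModule) fun g ↦ ?_
  rw [Representation.charpoly_smul_asModule, Representation.charpoly_smul_asModule,
    Representation.asAlgebraHom_of, Representation.asAlgebraHom_of, h g]

end MonoidAlgebra

/-! ### Framed representations -/

/-- For a framed representation `ρ : G →ₜ* GL_n(A)` the characteristic polynomial of the linear
map `v ↦ ρ(g) v` of `Aⁿ` underlying `FramedRep.toRepresentation ρ g` (Mathlib `LinearMap.charpoly`)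
is the matrix characteristic polynomial `FramedRep.charpoly ρ g = det(X - ρ(g))` (the map is
`Matrix.toLin' (ρ g)`; Mathlib `Matrix.charpoly_toLin'`). [folklore] -/
theorem charpoly_toRepresentation_apply {G : Type u} {A : Type v} [Group G] [TopologicalSpace G]
    [CommRing A] [TopologicalSpace A] {n : ℕ} (ρ : FramedRep G A n) (g : G) :
    (FramedRep.toRepresentation ρ g).charpoly = FramedRep.charpoly ρ g := by
  have e : (FramedRep.toRepresentation ρ g : (Fin n → A) →ₗ[A] (Fin n → A)) =
      Matrix.toLin' ((ρ g : GL (Fin n) A) : Matrix (Fin n) (Fin n) A) :=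
    LinearMap.ext fun v => by simp
  rw [e, Matrix.charpoly_toLin']
  rfl

/-! ### The registered stub -/

/-- **Stub `stub_not_isIrreducible_of_charpoly_eq`** of the line `reducible-companion-dispatch` for
the crux `IrreducibleGL3CM`: if a framed Galois representation `r : Γ_K →ₜ* GL_n(ℚ̄_ℓ)` has the
characteristic polynomials of a framed Galois representation `r₀` which is not irreducible, then
`r` is not irreducible (used with `r` a continuous semisimplification of `r₀`; the semisimplicity
hypothesis is carried by the registered signature but not used).  Immediate from
`not_isIrreducible_of_charpoly_eq` for the underlying representations on `ℚ̄_ℓⁿ`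
(`charpoly_toRepresentation_apply`).  Brauer–Nesbitt, Bourbaki, *Algèbre* VIII, § 20 n° 6.
[folklore] -/
theorem stub_not_isIrreducible_of_charpoly_eq : ∀ (K : Type) [Field K] (ℓ : ℕ) [Fact ℓ.Prime] (n : ℕ) (r₀ r : FramedGaloisRep K (PadicAlgCl ℓ) n), r.toGaloisRep.IsSemisimple → (∀ g, FramedRep.charpoly r g = FramedRep.charpoly r₀ g) → ¬ r₀.toGaloisRep.IsIrreducible → ¬ r.toGaloisRep.IsIrreducible := by
  intro K _ ℓ _ n r₀ r _ hcp h₀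
  refine not_isIrreducible_of_charpoly_eq (FramedRep.toRepresentation r₀)
    (FramedRep.toRepresentation r) (fun g ↦ ?_) h₀
  rw [charpoly_toRepresentation_apply, charpoly_toRepresentation_apply, hcp g]

end Summit.Langlands.Langlands.Theorems.IrreducibleGL3CM

end
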